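import Summits.AtomisticToContinuum.FouriersLaw.Theorems.EmbeddedDrudeMourreDrudeDissolutionOfMourre
import HarnessLib

/-!
# `DrudeDissolution ↔ MourreDissolution` (`--supports` stmt-AtomisticToContinuum-12593)

Crux `Summit.AtomisticToContinuum.FouriersLaw.Theses.EmbeddedDrudeMourre.DrudeDissolution`
(stmt-AtomisticToContinuum-12593, the route's target) and the conditional engine
`Summit.AtomisticToContinuum.FouriersLaw.Theses.EmbeddedDrudeMourre.MourreDissolution`
(stmt-AtomisticToContinuum-12594) have syntactically identical conclusions; the engine carries the extra
hypothesis `HasOddSectorGap ω₂ lam β`, which is discharged by the PROVED crux `FGRGap`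
(`Theorems.FGRGap_proof`), whence `drudeDissolution_of_mourreDissolution` (landed,
`Theorems/EmbeddedDrudeMourreDrudeDissolutionOfMourre.lean`). The converse is weakening. This file
records the resulting EQUIVALENCE of the two statement items: as of 2026-08-16 they are one and the same
open problem (the dissolved Drude atom of the low-temperature pinned anharmonic chain), so that either
item closes exactly when the other does. Bookkeeping only; it closes nothing by itself.
-/

namespace Summit.AtomisticToContinuum.FouriersLaw.Theorems.DrudeDissolution

open Summit.AtomisticToContinuum.FouriersLaw.Theses.EmbeddedDrudeMourre

/-- **`DrudeDissolution → MourreDissolution`** (weakening: the engine's gap hypothesis is simply not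
used). [folklore] -/
theorem mourreDissolution_of_drudeDissolution :
    Summit.AtomisticToContinuum.FouriersLaw.Theses.EmbeddedDrudeMourre.DrudeDissolution →
      Summit.AtomisticToContinuum.FouriersLaw.Theses.EmbeddedDrudeMourre.MourreDissolution :=
  fun h ω₂ lam β γ hω hl hβ hγ _ => h ω₂ lam β γ hω hl hβ hγ

/-- **`DrudeDissolution ↔ MourreDissolution`**: with `FGRGap` proved, the route's target
(stmt-AtomisticToContinuum-12593) and its conditional Mourre engine (stmt-AtomisticToContinuum-12594)
are equivalent statements. [folklore] -/
theorem drudeDissolution_iff_mourreDissolution :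
    Summit.AtomisticToContinuum.FouriersLaw.Theses.EmbeddedDrudeMourre.DrudeDissolution ↔
      Summit.AtomisticToContinuum.FouriersLaw.Theses.EmbeddedDrudeMourre.MourreDissolution :=
  ⟨mourreDissolution_of_drudeDissolution, drudeDissolution_of_mourreDissolution⟩

end Summit.AtomisticToContinuum.FouriersLaw.Theorems.DrudeDissolution
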